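import Literature.AlgebraicGeometry.GroupSchemes.FrobeniusKillsQuotientEtale   -- ★ p845810 `FrobKillEt.isIso_fac_of_finrank_le`, `finrank_alg_unitComponent_eq_and_comp_relFrobeniusOver_eq_one`; re-exports ★ p845457 (K1) and ★ `HopfIdealOfClosedSubgroup`
import HarnessLib

/-!
# At an ordinary point the unit-component ideal IS the Frobenius-kernel ideal: `ker Γ(G⁰ ↪ G) = ker Γ(Ker F^n ↪ G)` when `rk G⁰ ≤ rk Ker F^n`

Topic `Literature/AlgebraicGeometry/GroupSchemes`; namespace `Literature.AlgebraicGeometry.GroupSchemes.FrobKerUnit`.  THEOREMS ONLY (no definition,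
no instance, no notation, no named fact, no `sorry`).  Cell `hodgecm-mathlib` (D-0151), programme P6 «MOD» (crux hLiu418 = stmt-HodgeConjecture-24832,
`--supports`, count-neutral): DICT-constructor JUNCTION organ **(D6) «(J-ord) ORDINARY JUNCTION»** dealt by F0P6c-plan (g2) 17:18:24Z (A-p17 (g25));
consumer = ED. 4՚s `hKb4` glue of `heart_of_constructors` (★ p845739 (D4) speaks of the unit-component ideal, DICT՚s (b4′) of `kerF = kerFI`; this file
identifies them at ORDINARY points).  Sequel of ★ p845457 (K1) `FrobeniusKernelUnitComponent` (the INEQUALITY `ker Γ(G⁰) ≤ ker Γ(ι_{Ker F^n})`) and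
★ p845810 `FrobeniusKillsQuotientEtale` (`isIso_fac_of_finrank_le`: equal-rank rigidity; the ordinary assembly `rk G⁰ = q`).  HC_CM is proved only modulo
the printed citations until rung 0 closes; nothing here is about HC.

THE PRINT.  [Tate1997FiniteFlatGroupSchemes] (3.7): over a field a finite group scheme is `G⁰ × G^{ét}`, `G⁰` the unit component; [SGA3I] VII_A 4.1–4.3:
`Ker F_{G∕k}` is infinitesimal, so `Ker F^n ⊆ G⁰`, and at a point where the connected part is killed by `F^n` (ORDINARY: `G⁰ = 𝒢⁰[ϖ]` monogenic of rank
`q ≤ p^n`) the two closed subgroups COINCIDE.  Here: closed subschemes of the affine `G` nested with quotients of the same finite dimension are equal,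
read as an equality of ideals of `Γ(G)`.

* §1 (O1) for `jU : U ↪ G` a unit component (`IsMonHom ∧ IsOpenImmersion ∧ IsClosedImmersion ∧ ConnectedSpace`, P6c՚s 4-conjunct) and
  `hle : rk Γ(U) ≤ rk Γ(G) ⧸ ker Γ(ι_{Ker F^n})`: **`ker_appTop_unitComponent_eq_ker_appTop_kerι_relFrobeniusOver`** (`ker Γ(jU) = ker Γ(ι)`),
  **`ker_ptEquiv_unitComponent_eq_ker_appTop_kerι_relFrobeniusOver`** (the same keyed on `ker (ptEquiv G Γ(U) (isoSpecOver⁻¹ ≫ jU))`, the (E-b)∕(K-b)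
  points currency of ★ K1), `finrank_alg_unitComponent_eq_of_le` (`hle` is an equality).
* §2 (O2) over `k = k̄`, from `rk G = q²`, `rk Ker F^n = q` (colength of `kerFI`) and an ÉTALE admissible ideal `I` of colength `q`:
  **`ker_ptEquiv_unitComponent_eq_ker_appTop_kerι_relFrobeniusOver_of_etale`**, `ker_appTop_unitComponent_eq_ker_appTop_kerι_relFrobeniusOver_of_etale`,
  `finrank_alg_unitComponent_eq_of_etale` (`rk G⁰ = q`, ★ assembly re-keyed).

## References
* [Tate1997FiniteFlatGroupSchemes] J. Tate, *Finite flat group schemes*, in: Modular Forms and Fermat's Last Theorem (1997) — (3.7).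
* [SGA3I] M. Demazure, A. Grothendieck (eds.), *SGA 3, Tome I*, Exp. VII_A §4, 4.1–4.3.
* [Waterhouse1979] W. C. Waterhouse, *Introduction to Affine Group Schemes*, GTM 66 (1979) — §2.1 (closed subgroups ↔ Hopf ideals).
-/

set_option autoImplicit false

-- Mathlib's `Over`/`Scheme` APIs and the transported group structure on the twist are stated across semireducible wrappers
-- (as in ★ `GroupSchemes/*`).
set_option backward.isDefEq.respectTransparency false

-- As in ★ (FKw) ∕ ★ FrobKillEt: statements mentioning `relFrobeniusOver` need the slow instance search through the transported structure of
-- the twist; no proof `maxHeartbeats` budget is raised.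
set_option synthInstance.maxHeartbeats 200000

noncomputable section

open CategoryTheory CategoryTheory.Limits AlgebraicGeometry MonoidalCategory CartesianMonoidalCategory

open scoped MonObj Obj

universe u

namespace Literature.AlgebraicGeometry.GroupSchemes.FrobKerUnit

open Literature.AlgebraicGeometry.Motives GroupSchemeKernel AffineGroupScheme

variable {k : Type u} [Field k] (p : ℕ) [ExpChar k p] (n : ℕ)

/-! ## §1 (O1) Equality of the two ideals of `Γ(G)` under the rank inequality `rk G⁰ ≤ rk Ker F^n` -/

section O1

variable (G : SchemeOver k) [GrpObj G] [IsAffine G.left] [IsFinite G.hom]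
  (U : SchemeOver k) [GrpObj U] [IsAffine U.left] (jU : U ⟶ G)

/-- **`ker Γ(jU) = ker Γ(ι_{Ker F^n})` when `rk G⁰ ≤ rk Ker F^n`** (`Γ(jU)`-keyed form): the factorisation `v : Ker F^n_G → G⁰` of `ι` through the unit
component `jU : G⁰ ↪ G` (★ `existsUnique_kerι_relFrobeniusOver_fac`) is an isomorphism (★ `FrobKillEt.isIso_fac_of_finrank_le`), so `Γ(ι) = Γ(v) ∘ Γ(jU)` with
`Γ(v)` injective and the two kernels agree. [cite: Tate1997FiniteFlatGroupSchemes, (3.7)] [cite: SGA3I, VII_A 4.1–4.3] -/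
theorem ker_appTop_unitComponent_eq_ker_appTop_kerι_relFrobeniusOver
    (hU : IsMonHom jU ∧ IsOpenImmersion jU.left ∧ IsClosedImmersion jU.left ∧ ConnectedSpace ↥U.left)
    (hle : Module.finrank k (Alg U) ≤
      Module.finrank k (Alg G ⧸ (RingHom.ker (kerι (relFrobeniusOver p n G)).left.appTop.hom : Ideal (Alg G)))) :
    (RingHom.ker jU.left.appTop.hom : Ideal (Alg G)) = RingHom.ker (kerι (relFrobeniusOver p n G)).left.appTop.hom := by
  have hU' := hU
  obtain ⟨hmon, hop, hcl, -⟩ := hU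
  haveI := hmon; haveI := hop; haveI := hcl
  obtain ⟨v, hv, -⟩ := existsUnique_kerι_relFrobeniusOver_fac p n jU
  haveI := FrobKillEt.isIso_fac_of_finrank_le p n G U jU hU' v hv hle
  haveI : IsIso v.left := (inferInstance : IsIso ((Over.forget _).map v))
  have hinj : Function.Injective v.left.appTop.hom := (ConcreteCategory.bijective_of_isIso v.left.appTop).1
  rw [← hv, Over.comp_left, Scheme.Hom.comp_appTop, CommRingCat.hom_comp, RingHom.ker_comp_of_injective _ hinj]

/-- **(O1) ORDINARY JUNCTION — `ker (ptEquiv G Γ(G⁰) (isoSpecOver⁻¹ ≫ jU)) = ker Γ(ι_{Ker F^n})` when `rk G⁰ ≤ rk Ker F^n`**: the unit-component ideal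
in the (E-b)∕(K-b) points currency (★ `ker_ptEquiv_isoSpecOver_inv_comp_eq`: it is `ker Γ(jU)`) EQUALS the Frobenius-kernel ideal `kerFI` of the DICT
constructors; `≤` alone is ★ (K1) `ker_ptEquiv_le_ker_appTop_kerι_relFrobeniusOver_of_unitComponent`. [cite: Tate1997FiniteFlatGroupSchemes, (3.7)]
[cite: SGA3I, VII_A 4.1–4.3] [cite: Waterhouse1979, §2.1] -/
theorem ker_ptEquiv_unitComponent_eq_ker_appTop_kerι_relFrobeniusOver
    (hU : IsMonHom jU ∧ IsOpenImmersion jU.left ∧ IsClosedImmersion jU.left ∧ ConnectedSpace ↥U.left)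
    (hle : Module.finrank k (Alg U) ≤
      Module.finrank k (Alg G ⧸ (RingHom.ker (kerι (relFrobeniusOver p n G)).left.appTop.hom : Ideal (Alg G)))) :
    RingHom.ker (ptEquiv G (Alg U) ((isoSpecOver U).inv ≫ jU)).toRingHom =
      (RingHom.ker (kerι (relFrobeniusOver p n G)).left.appTop.hom : Ideal (Alg G)) := by
  rw [ker_ptEquiv_isoSpecOver_inv_comp_eq]
  exact ker_appTop_unitComponent_eq_ker_appTop_kerι_relFrobeniusOver p n G U jU hU hle

/-- **Rank form of the hypothesis**: `rk G⁰ ≤ rk Ker F^n` iff `rk G⁰ = rk Ker F^n` (the other inequality is ★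
`FrobKillEt.finrank_quotient_ker_le_finrank_alg_unitComponent`). [cite: Tate1997FiniteFlatGroupSchemes, (3.7)] [cite: SGA3I, VII_A 4.1–4.3] -/
theorem finrank_alg_unitComponent_eq_of_le
    (hU : IsMonHom jU ∧ IsOpenImmersion jU.left ∧ IsClosedImmersion jU.left ∧ ConnectedSpace ↥U.left)
    (hle : Module.finrank k (Alg U) ≤
      Module.finrank k (Alg G ⧸ (RingHom.ker (kerι (relFrobeniusOver p n G)).left.appTop.hom : Ideal (Alg G)))) :
    Module.finrank k (Alg U) =
      Module.finrank k (Alg G ⧸ (RingHom.ker (kerι (relFrobeniusOver p n G)).left.appTop.hom : Ideal (Alg G))) :=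
  le_antisymm hle (FrobKillEt.finrank_quotient_ker_le_finrank_alg_unitComponent p n G U jU hU)

end O1

/-! ## §2 (O2) The ordinary corollary over an algebraically closed field -/

section O2

variable [IsAlgClosed k] (G : SchemeOver k) [GrpObj G] [IsAffine G.left] [IsFinite G.hom]
  (U : SchemeOver k) [GrpObj U] [IsAffine U.left] (jU : U ⟶ G)

/-- **(O2) ORDINARY COROLLARY — at an ORDINARY point the unit-component ideal IS the Frobenius-kernel ideal**: for `k = k̄`, `G` finite affine of rank
`q²` with unit component `jU : G⁰ ↪ G`, Frobenius-kernel ideal of colength `q`, and an ÉTALE admissible ideal `I` of colength `q` (`V(I)` étale), one has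
`rk G⁰ = q` (★ `FrobKillEt.finrank_alg_unitComponent_eq_and_comp_relFrobeniusOver_eq_one`), hence §1 applies:
`ker (ptEquiv G Γ(G⁰) (isoSpecOver⁻¹ ≫ jU)) = ker Γ(ι_{Ker F^n})`. [cite: Tate1997FiniteFlatGroupSchemes, (3.7)] [cite: SGA3I, VII_A 4.1–4.3] -/
theorem ker_ptEquiv_unitComponent_eq_ker_appTop_kerι_relFrobeniusOver_of_etale
    (hU : IsMonHom jU ∧ IsOpenImmersion jU.left ∧ IsClosedImmersion jU.left ∧ ConnectedSpace ↥U.left) {q : ℕ}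
    (hrkG : Module.finrank k (Alg G) = q * q)
    (hrkF : Module.finrank k (Alg G ⧸ (RingHom.ker (kerι (relFrobeniusOver p n G)).left.appTop.hom : Ideal (Alg G))) = q)
    (I : Ideal (Alg G)) (hIq : Module.finrank k (Alg G ⧸ I) = q) (hIet : Etale (Motives.specOver k (Alg G ⧸ I)).hom) :
    RingHom.ker (ptEquiv G (Alg U) ((isoSpecOver U).inv ≫ jU)).toRingHom =
      (RingHom.ker (kerι (relFrobeniusOver p n G)).left.appTop.hom : Ideal (Alg G)) := by
  have hUq := (FrobKillEt.finrank_alg_unitComponent_eq_and_comp_relFrobeniusOver_eq_one p n G U jU hU hrkG hrkF I hIq hIet).1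
  exact ker_ptEquiv_unitComponent_eq_ker_appTop_kerι_relFrobeniusOver p n G U jU hU (by rw [hUq, hrkF])

/-- The same in the `Γ(jU)`-keyed form: `ker Γ(jU) = ker Γ(ι_{Ker F^n})` at an ordinary point. [cite: Tate1997FiniteFlatGroupSchemes, (3.7)]
[cite: SGA3I, VII_A 4.1–4.3] -/
theorem ker_appTop_unitComponent_eq_ker_appTop_kerι_relFrobeniusOver_of_etale
    (hU : IsMonHom jU ∧ IsOpenImmersion jU.left ∧ IsClosedImmersion jU.left ∧ ConnectedSpace ↥U.left) {q : ℕ}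
    (hrkG : Module.finrank k (Alg G) = q * q)
    (hrkF : Module.finrank k (Alg G ⧸ (RingHom.ker (kerι (relFrobeniusOver p n G)).left.appTop.hom : Ideal (Alg G))) = q)
    (I : Ideal (Alg G)) (hIq : Module.finrank k (Alg G ⧸ I) = q) (hIet : Etale (Motives.specOver k (Alg G ⧸ I)).hom) :
    (RingHom.ker jU.left.appTop.hom : Ideal (Alg G)) = RingHom.ker (kerι (relFrobeniusOver p n G)).left.appTop.hom := by
  have hUq := (FrobKillEt.finrank_alg_unitComponent_eq_and_comp_relFrobeniusOver_eq_one p n G U jU hU hrkG hrkF I hIq hIet).1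
  exact ker_appTop_unitComponent_eq_ker_appTop_kerι_relFrobeniusOver p n G U jU hU (by rw [hUq, hrkF])

/-- **`rk G⁰ = q` at an ordinary point** (the rank clause alone, re-exported in this file's binder shape from ★
`FrobKillEt.finrank_alg_unitComponent_eq_and_comp_relFrobeniusOver_eq_one`). [cite: Tate1997FiniteFlatGroupSchemes, (3.7)] -/
theorem finrank_alg_unitComponent_eq_of_etale
    (hU : IsMonHom jU ∧ IsOpenImmersion jU.left ∧ IsClosedImmersion jU.left ∧ ConnectedSpace ↥U.left) {q : ℕ}
    (hrkG : Module.finrank k (Alg G) = q * q)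
    (hrkF : Module.finrank k (Alg G ⧸ (RingHom.ker (kerι (relFrobeniusOver p n G)).left.appTop.hom : Ideal (Alg G))) = q)
    (I : Ideal (Alg G)) (hIq : Module.finrank k (Alg G ⧸ I) = q) (hIet : Etale (Motives.specOver k (Alg G ⧸ I)).hom) :
    Module.finrank k (Alg U) = q :=
  (FrobKillEt.finrank_alg_unitComponent_eq_and_comp_relFrobeniusOver_eq_one p n G U jU hU hrkG hrkF I hIq hIet).1

end O2

end Literature.AlgebraicGeometry.GroupSchemes.FrobKerUnit

end
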